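/-
Copyright: statement-level skeleton of a published paper (lit-balaban cell, Phase-2 proof seat p39 gen 6). No proof claims
beyond what the kernel checks below.
-/
import Literature.MathematicalPhysics.QuantumFieldTheory.Balaban1983to89.B3Sect3KernelsZeroTorus

/-!
# B3 — T. Bałaban, *(Higgs)₂,₃ quantum fields in a finite volume. III. Renormalization*, CMP **88** (1983) 411–445
[Balaban1983Higgs3], p. 437 [PDF 27]: the RESCALED zero-field torus propagator `G^ξ_{j″}(0)` of (3.15)/(3.16) — *"Rescaling it
from the η-lattice to the L^{−j″}-lattice (x, x′ = L^{j″}ηy, L^{j″}ηy′, y, y′ ∈ T_{L^{−j″}}) we get the same expression but with L^{−j″}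
instead of η. For simplicity let us denote L^{−j″} = ξ"* — for the MODEL INSTANCE `A = B̃ = 0`, `Ω = T_η` (Bałaban's scalar torus
tower `B1RG242Torus.tower`), with the printed bounds *"|G^ξ_{j″}(0; y, y′)| ≦ O(1)e^{−δ₀|y−y′|}/|y − y′| … and the corresponding
inequalities for derivatives"* PROVED at ALL sites (diagonal included), with the decay on the scale of the propagator itself,
uniformly in the volume and in the scale `k = j″`

statement-level skeleton of published theorems with citation tags; proofs where landed; nothing here is a claim about
the Yang–Mills mass gap

PDF held: `paper:balaban1983-higgs-2-3-quantum-fields-finite-volume` (journal page = PDF page + 410); p. 437 [PDF 27] read in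
the OCR text (`p0027.txt`).  Row **B3.Eq3.11-3.17** of `HOME/lit-balaban-r15/ROWS-B3.md` (fold owner r15), sub-display (3.16) and
the kernel-bound sentence after it.  THIS FILE is file 2 of this seat's gen-6 discharge of the last kernel hypothesis `hM` of p20's
`B3Bound316.abs_bracket316_le` at the zero-field torus instance.  Inputs used BY NAME: p20 g5's `B3Sect3KernelsZeroTorus.gpiece` /
`gpiece_bounds` (the scale PIECES `G^η_{(j)} = η^{−d}·pieceT j` with value / row-difference bounds at all sites and scale-sharp decay),
p03 g4's `B3Ineq210ZeroTorus.sum_pieceT` (the tower identity (2.6): `Σ_{j<k} pieceT j = G_k`), this seat's gen-5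
`B3GkZeroBoxPointwise.scaleSum_le` / `scaleSum_zero_le` (the sum over scales).
* §1 THE RESCALED SPACING `ξ = L^{−k}` (`Params.eta k`): `ξ = ε/(L^kε)`, `0 < ξ ≤ 1`, `ξ^d = L^{−kd}`, and `ξ·N ≥ 1` on `T^{(0)}`
  (`2L^{m+K}` sites per direction) for `k ≤ m + K` — the hypothesis `hN` of p03's torus free propagator `CxiT ξ`.
* §2 **`G0xi P a msq k : Kernel P 0`**, the `ξ^d`-NORMALISED KERNEL of the rescaled operator `(L^kε)^{−2}G_k(T_ε,0)` =
  `(−Δ^ξ + (L^kε)²m² + a_kP_k)^{−1}` (B1 (2.20): `G_k = (−Δ^ε + m² + a_k(L^kε)^{−2}P_k)^{−1}` and `−Δ^ε = (L^kε)^{−2}(−Δ^ξ)`):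
  `G0xi(y,y′) = ξ^{−d}(L^kε)^{−2}G_k(y,y′) = (L^kε)^{d−2}·Σ_{j<k} gpiece j (y,y′)` (`G0xi_eq_sum_gpiece`).
* §3 THE SCALE SUM in the max form (diagonal included): `Σ_{j<k}(L^j)^{−p}e^{−δn/L^j} ≤ (C_s + C_z)·max(1,n)^{−p}e^{−(δ/2)n/L^k}` for
  every lattice distance `n ∈ ℕ` (`scaleSum_le_max`).
* §4 **THE PRINTED BOUNDS FOR `G^ξ_k(0)`, d = 3, HYPOTHESIS-FREE** (`G0xi_bounds`): for odd `L > 1`, `a > 0`, `m² ≥ 0` there are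
  `δ, C > 0` (functions of `L, a, m²`) such that for EVERY volume `P = (3, L, m, K)`, every `1 ≤ k ≤ K`, all `μ, y, y′`:
  `|G^ξ_k(0)(y,y′)| ≤ C·(ξ·max(1,|y−y′|_∞))^{−1}e^{−δξ|y−y′|_∞}` and `|(∂^ξ_μG^ξ_k(0))(y,y′)| ≤ C·(ξ·max(1,|y−y′|_∞))^{−2}e^{−δξ|y−y′|_∞}`
  — at `y′ ≠ y` exactly the printed `O(1)e^{−δ₀|y−y′|}/|y−y′|` and its derivative companion in the rescaled variables
  (`G0xi_bounds_offdiag`: the shapes `hG` of `B3Bound316.abs_bracket316_le` and of the profile hypotheses of `B3KernelConvolutionTorus`).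
* §4 v1.1 rider `eta_mul_abs_G0xi_diag_le`: the diagonal case, p. 438 *"ηG_k(x,x) is convergent to some finite constant"* —
  boundedness half for the torus propagator: `ξ·|G^ξ_k(0;y,y)| ≤ C` uniformly in volume and scale (the limit is not claimed).
HONEST SCOPE: `A = B̃ = 0`, `U ≡ 1`, `Ω` = the whole torus (the scope of `B4Thm110ZeroTorus` / `B3Ineq210ZeroTorus`); `d = 3` for §4;
constants existential, uniform in the volume `(m, K)` and the scale; the sup torus distance `supDist` (≤ the Euclidean one).  Mathlib +
the cited tree files only; ONE `def` with body (`G0xi`), no named facts; standard axioms.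
Unit `lit-balaban-p39-g6` (Phase-2 proof seat p39, gen 6), HOME `run/shared/lean/pub/lit-balaban/`, 2026-08-21.
-/

open scoped BigOperators

namespace Literature.MathematicalPhysics.QuantumFieldTheory.Balaban1983to89.B3GkZeroTorusRescaled

open Matrix Finset B1RG242Torus B3Ineq210ZeroTorus B3Sect3KernelsZeroTorus
open LatticeFieldCalculus B3Sect3ScalarSelfEnergy B3TorusRadialSums
open B3GkZeroBoxPointwise (scaleSum_le scaleSum_zero_le)

noncomputable section

/-! ## §1 The rescaled spacing `ξ = L^{−k}` -/

section Spacing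

variable (P : Params)

/-- `ξ = L^{−k}` (`Params.eta`) as an inverse power. [cite: Balaban1983Higgs3, (3.16) p.437] -/
theorem eta_eq_inv_pow (k : ℕ) : P.eta k = ((P.L : ℝ) ^ k)⁻¹ := by
  unfold Params.eta; rw [inv_pow]

/-- `0 < ξ`. [cite: Balaban1983Higgs3, (3.16) p.437] -/
theorem eta_pos (k : ℕ) : 0 < P.eta k := by
  rw [eta_eq_inv_pow]; exact inv_pos.mpr (pow_pos P.cast_L_pos _)

/-- `ξ ≤ 1`. [cite: Balaban1983Higgs3, (3.16) p.437] -/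
theorem eta_le_one (k : ℕ) : P.eta k ≤ 1 := by
  rw [eta_eq_inv_pow]
  exact inv_le_one_of_one_le₀ (one_le_pow₀ (one_lt_cast_L P).le)

/-- The rescaling `x = L^kη·y`: `(L^kε)·ξ = ε` (the fine spacing `η = ε` in the tower's units). [cite: Balaban1983Higgs3, (3.16) p.437] -/
theorem spacing_mul_eta (k : ℕ) : P.spacing k * P.eta k = P.eps := by
  rw [eta_eq_inv_pow, Params.spacing, mul_comm ((P.L : ℝ) ^ k), mul_assoc,
    mul_inv_cancel₀ (pow_ne_zero _ P.cast_L_pos.ne'), mul_one]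

/-- `ξ^d = L^{−kd}`, the weight of the `k`-fold block average `Q_k`. [cite: Balaban1983Higgs3, (3.16) p.437] -/
theorem eta_pow_eq (k : ℕ) : P.eta k ^ P.d = ((((P.L : ℝ) ^ P.d)⁻¹) ^ k) := by
  rw [eta_eq_inv_pow, ← inv_pow, ← inv_pow, ← pow_mul, ← pow_mul, mul_comm]

/-- `ξ·N ≥ 1` on `T^{(0)}` (`N = 2L^{m+K}` sites per direction) for `k ≤ m + K`: the torus `T_{L^{−k}}` of the print has side `≥ 1`
(hypothesis `hN` of p03's `B3CxiTorusBound.CxiT_hC`). [cite: Balaban1983Higgs3, (3.16) p.437] -/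
theorem one_le_eta_mul_sitesPerDir {k : ℕ} (hk : k ≤ P.m + P.K) : 1 ≤ P.eta k * (P.sitesPerDir 0 : ℝ) := by
  have h0 : P.sitesPerDir 0 = P.L ^ k * P.sitesPerDir k := by rw [sitesPerDir_zero_eq P k, lvl_of_le P hk]
  rw [h0, eta_eq_inv_pow, Nat.cast_mul, Nat.cast_pow, ← mul_assoc, inv_mul_cancel₀ (pow_ne_zero _ P.cast_L_pos.ne'),
    one_mul]
  exact_mod_cast (P.one_lt_sitesPerDir k).le

/-- `L^kε ≤ 1` for `k ≤ K` (the unit lattice is reached at `k = K`). [cite: Balaban1983Higgs3, (3.16) p.437] -/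
theorem spacing_le_one {k : ℕ} (hk : k ≤ P.K) : P.spacing k ≤ 1 := by
  rw [← P.spacing_K]; exact B4Ineq116Torus.spacing_le_spacing P hk

/-- `ξ⁻¹ = L^kε·ε⁻¹`. [cite: Balaban1983Higgs3, (3.16) p.437] -/
theorem eta_inv_eq (k : ℕ) : (P.eta k)⁻¹ = P.spacing k * P.eps⁻¹ := by
  rw [← spacing_mul_eta P k, mul_inv, ← mul_assoc, mul_inv_cancel₀ (P.spacing_pos k).ne', one_mul]

end Spacing

/-! ## §2 The rescaled propagator `G^ξ_k(0)` as a Sect.-3 kernel -/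

section Kernel

variable (P : Params)

/-- **`G^ξ_k(0)`**, the `ξ^d`-normalised kernel on the rescaled torus `T_{L^{−k}}` (same sites as `T^{(0)}`, spacing `ξ = L^{−k}`) of
`(L^kε)^{−2}G_k(T_ε,0) = (−Δ^ξ + (L^kε)²m² + a_kP_k)^{−1}`: `G0xi(y,y′) = ξ^{−d}(L^kε)^{−2}G_k(y,y′)` — the object `G^ξ_{j″}(0)` of (3.16) at
the zero-field torus instance. [cite: Balaban1983Higgs3, (3.16) p.437] -/
def G0xi (a msq : ℝ) (k : ℕ) : Kernel P 0 := fun y y' =>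
  (P.eta k ^ P.d)⁻¹ * ((P.spacing k ^ 2)⁻¹ * (tower P a msq).G k y y')

variable {P}

/-- kernel: the rescaling factor `ξ^{−d}(L^kε)^{−2} = (L^kε)^{d−2}·ε^{−d}` (`d ≥ 2`). [cite: Balaban1983Higgs3, (3.16) p.437] -/
theorem rescale_factor_eq (hd : 2 ≤ P.d) (k : ℕ) :
    (P.eta k ^ P.d)⁻¹ * (P.spacing k ^ 2)⁻¹ = P.spacing k ^ (P.d - 2) * (P.eps ^ P.d)⁻¹ := by
  rw [← inv_pow, eta_inv_eq, mul_pow, inv_pow]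
  have hs : P.spacing k ≠ 0 := (P.spacing_pos k).ne'
  have hsplit : P.spacing k ^ P.d = P.spacing k ^ (P.d - 2) * P.spacing k ^ 2 := by
    rw [← pow_add]; congr 1; omega
  rw [hsplit]
  field_simp

/-- **`G^ξ_k(0) = (L^kε)^{d−2}·Σ_{j<k}G^η_{(j)}`**: the rescaled kernel is the rescaled sum (2.6) of the scale pieces (p03's `sum_pieceT`,
p20's `gpiece = η^{−d}·pieceT`). [cite: Balaban1983Higgs3, (2.6) p.424, (3.16) p.437] -/
theorem G0xi_eq_sum_gpiece {a msq : ℝ} (ha : 0 < a) (hm : 0 ≤ msq) (hd : 2 ≤ P.d) {k : ℕ} (hk : 1 ≤ k) (y y' : Site P 0) :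
    G0xi P a msq k y y' = P.spacing k ^ (P.d - 2) * ∑ j ∈ range k, gpiece P a msq k j y y' := by
  unfold G0xi gpiece
  rw [← mul_assoc, rescale_factor_eq hd, ← sum_pieceT ha hm hk, Matrix.sum_apply]
  simp only [Finset.mul_sum]
  exact Finset.sum_congr rfl fun j _ => by ring

/-- The row difference of the rescaled kernel is the rescaled sum of the row differences of the pieces:
`(∂^ξ_μG^ξ_k(0))(y,y′) = (L^kε)^{d−1}·Σ_{j<k}(∂^η_μG^η_{(j)})(y,y′)` (`∂^ξ = (L^kε)∂^η`). [cite: Balaban1983Higgs3, (3.16) p.437] -/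
theorem d1Kernel_G0xi_eq {a msq : ℝ} (ha : 0 < a) (hm : 0 ≤ msq) (hd : 2 ≤ P.d) {k : ℕ} (hk : 1 ≤ k) (μ : Fin P.d)
    (y y' : Site P 0) :
    d1Kernel (P.eta k)⁻¹ μ (G0xi P a msq k) y y' =
      P.spacing k ^ (P.d - 1) * ∑ j ∈ range k, d1Kernel P.eps⁻¹ μ (gpiece P a msq k j) y y' := by
  simp only [d1Kernel, G0xi_eq_sum_gpiece ha hm hd hk, eta_inv_eq]
  have hε : P.eps ≠ 0 := P.eps_pos.ne'
  have hsplit : P.spacing k ^ (P.d - 1) = P.spacing k * P.spacing k ^ (P.d - 2) := by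
    rw [← pow_succ']; congr 1; omega
  rw [hsplit, Finset.mul_sum, Finset.mul_sum, Finset.mul_sum, ← Finset.sum_sub_distrib, Finset.mul_sum]
  refine Finset.sum_congr rfl fun j _ => ?_
  field_simp

end Kernel

/-! ## §3 The scale sum in the max form (diagonal included) -/

section ScaleSum

variable {L δ : ℝ}

/-- kernel: the constant of `scaleSum_le` is nonnegative. [cite: Balaban1983Higgs3, (2.10) p.426] -/
theorem scaleConst_nonneg (hL : 1 < L) (hδ : 0 < δ) (p : ℕ) :
    0 ≤ L / (L - 1) * Real.exp (δ / 2) + (p.factorial : ℝ) / (δ / 2) ^ p * (1 - Real.exp (-(δ / 2 * (L - 1))))⁻¹ := by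
  have h1 : 0 < L - 1 := by linarith
  have h2 : Real.exp (-(δ / 2 * (L - 1))) < 1 := Real.exp_lt_one_iff.mpr (by nlinarith)
  have h3 : 0 < 1 - Real.exp (-(δ / 2 * (L - 1))) := by linarith
  positivity

/-- kernel: the constant of `scaleSum_zero_le` is nonnegative. [cite: Balaban1983Higgs3, (2.10) p.426] -/
theorem zeroConst_nonneg (hL : 1 < L) {p : ℕ} (hp : 1 ≤ p) : 0 ≤ (1 - (L ^ p)⁻¹)⁻¹ := by
  have hq1 : (L ^ p)⁻¹ < 1 := inv_lt_one_of_one_lt₀ (one_lt_pow₀ hL (by omega))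
  have : 0 < 1 - (L ^ p)⁻¹ := by linarith
  positivity

/-- **The scale sum with the diagonal included**: for `L > 1`, `δ > 0`, `p ≥ 1`, every `k` and every lattice distance `n ∈ ℕ`,
`Σ_{j<k}(L^j)^{−p}e^{−δn/L^j} ≤ (C_s + C_z)·(max(1,n))^{−p}·e^{−(δ/2)n/L^k}` (`C_s`, `C_z` the constants of `scaleSum_le`,
`scaleSum_zero_le`): off the diagonal the sharp `scaleSum_le` (decay on the top scale `L^{k−1} ≤ L^k`), on it the geometric sum.
[cite: Balaban1983Higgs3, (2.10) p.426, (3.16) p.437] -/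
theorem scaleSum_le_max (hL : 1 < L) (hδ : 0 < δ) {p : ℕ} (hp : 1 ≤ p) (k n : ℕ) :
    ∑ j ∈ range k, (L ^ j)⁻¹ ^ p * Real.exp (-(δ * n / L ^ j)) ≤
      (L / (L - 1) * Real.exp (δ / 2) + (p.factorial : ℝ) / (δ / 2) ^ p * (1 - Real.exp (-(δ / 2 * (L - 1))))⁻¹ +
          (1 - (L ^ p)⁻¹)⁻¹) *
        ((max (1 : ℝ) (n : ℝ))⁻¹ ^ p * Real.exp (-(δ / 2 * ((n : ℝ) / L ^ k)))) := by
  have hL0 : 0 < L := by linarith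
  have hCs := scaleConst_nonneg hL hδ p
  have hCz := zeroConst_nonneg hL hp
  set Cs := L / (L - 1) * Real.exp (δ / 2) + (p.factorial : ℝ) / (δ / 2) ^ p * (1 - Real.exp (-(δ / 2 * (L - 1))))⁻¹
    with hCsdef
  set Cz := (1 - (L ^ p)⁻¹)⁻¹ with hCzdef
  rcases Nat.eq_zero_or_pos n with hn | hn
  · -- the diagonal: all exponentials are 1
    subst hn
    simp only [Nat.cast_zero, mul_zero, zero_div, neg_zero, Real.exp_zero, mul_one]
    rw [max_eq_left (zero_le_one' ℝ), inv_one, one_pow, mul_one]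
    exact (scaleSum_zero_le hL hp k).trans (by linarith)
  · have hn0 : (0 : ℝ) < n := by exact_mod_cast hn
    have hmax : max (1 : ℝ) (n : ℝ) = n := max_eq_right (by exact_mod_cast hn)
    rw [hmax]
    have h := scaleSum_le hL hδ hp k hn0
    -- the top scale: `n/L^{k−1} ≥ n/L^k`
    have hexp : Real.exp (-(δ / 2 * ((n : ℝ) / L ^ (k - 1)))) ≤ Real.exp (-(δ / 2 * ((n : ℝ) / L ^ k))) := by
      apply Real.exp_le_exp.mpr
      have hpow : L ^ (k - 1) ≤ L ^ k := pow_le_pow_right₀ hL.le (Nat.sub_le k 1)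
      have hdiv : (n : ℝ) / L ^ k ≤ (n : ℝ) / L ^ (k - 1) :=
        div_le_div_of_nonneg_left hn0.le (pow_pos hL0 _) hpow
      nlinarith
    calc ∑ j ∈ range k, (L ^ j)⁻¹ ^ p * Real.exp (-(δ * n / L ^ j))
        ≤ Cs * (n : ℝ)⁻¹ ^ p * Real.exp (-(δ / 2 * ((n : ℝ) / L ^ (k - 1)))) := h
      _ ≤ Cs * (n : ℝ)⁻¹ ^ p * Real.exp (-(δ / 2 * ((n : ℝ) / L ^ k))) :=
          mul_le_mul_of_nonneg_left hexp (by positivity)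
      _ ≤ (Cs + Cz) * ((n : ℝ)⁻¹ ^ p * Real.exp (-(δ / 2 * ((n : ℝ) / L ^ k)))) := by
          rw [mul_assoc]
          exact mul_le_mul_of_nonneg_right (by linarith) (by positivity)

end ScaleSum

/-! ## §4 The printed bounds for `G^ξ_k(0)` and `∂^ξG^ξ_k(0)`, d = 3, all sites -/

section Bounds

/-- kernel: the piece decay in the `ℓ¹` distance dominates the decay in the `ℓ^∞` distance on the scale `L^j`:
`e^{−δ(L^jε)^{−1}ε|x−x′|₁} ≤ e^{−δ|x−x′|_∞/L^j}`. [cite: Balaban1983Higgs3, (2.10) p.426] -/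
theorem piece_exp_le (P : Params) {δ : ℝ} (hδ : 0 ≤ δ) (j : ℕ) (x x' : Site P 0) :
    Real.exp (-(δ * (P.spacing j)⁻¹ * (P.eps * (Site.tdist x x' : ℝ)))) ≤
      Real.exp (-(δ * (supDist x x' : ℝ) / (P.L : ℝ) ^ j)) := by
  apply Real.exp_le_exp.mpr
  have hε : P.eps ≠ 0 := P.eps_pos.ne'
  have hLj : 0 < (P.L : ℝ) ^ j := pow_pos P.cast_L_pos j
  have h1 : (supDist x x' : ℝ) ≤ (Site.tdist x x' : ℝ) := by exact_mod_cast supDist_le_tdist x x'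
  have h2 : (P.spacing j)⁻¹ * P.eps = ((P.L : ℝ) ^ j)⁻¹ := by
    rw [Params.spacing, mul_inv, mul_assoc, inv_mul_cancel₀ hε, mul_one]
  have h3 : δ * (P.spacing j)⁻¹ * (P.eps * (Site.tdist x x' : ℝ)) = δ * (Site.tdist x x' : ℝ) / (P.L : ℝ) ^ j := by
    rw [show δ * (P.spacing j)⁻¹ * (P.eps * (Site.tdist x x' : ℝ)) = δ * ((P.spacing j)⁻¹ * P.eps) * (Site.tdist x x' : ℝ)
      by ring, h2]
    field_simp
  rw [h3]
  have h4 : δ * (supDist x x' : ℝ) / (P.L : ℝ) ^ j ≤ δ * (Site.tdist x x' : ℝ) / (P.L : ℝ) ^ j :=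
    div_le_div_of_nonneg_right (mul_le_mul_of_nonneg_left h1 hδ) hLj.le
  linarith

/-- **THE PRINTED KERNEL BOUNDS FOR THE RESCALED ZERO-FIELD PROPAGATOR, AT ALL SITES** (`d = 3`).  For odd `L > 1`, `a > 0`, `m² ≥ 0`
there are `δ, C > 0` (functions of `L, a, m²`) such that for EVERY volume `P = (3, L, m, K)` of Bałaban's scalar torus tower, every
scale `1 ≤ k ≤ K` (`ξ = L^{−k}`), all `μ, y, y′` (with `|y − y′| = |y − y′|_∞` in lattice steps):
`|G^ξ_k(0)(y,y′)| ≤ C(ξ·max(1,|y−y′|))^{−1}e^{−δξ|y−y′|}` and `|(∂^ξ_μG^ξ_k(0))(y,y′)| ≤ C(ξ·max(1,|y−y′|))^{−2}e^{−δξ|y−y′|}` — p. 437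
*"|G^ξ_{j″}(0; y, y′)| ≦ O(1)e^{−δ₀|y−y′|}/|y − y′| … and the corresponding inequalities for derivatives"* for the model instance, the
diagonal included (there `ξ^{−1}`, `ξ^{−2}`).  Route: (2.6) + the piece bounds (2.10) (`gpiece_bounds`) summed over the scales
(`scaleSum_le_max`). [cite: Balaban1983Higgs3, (3.16) p.437, (2.10) p.426] -/
theorem G0xi_bounds (L : ℕ) (hL : Odd L ∧ 1 < L) {a : ℝ} (ha : 0 < a) {msq : ℝ} (hmsq : 0 ≤ msq) :
    ∃ δ C : ℝ, 0 < δ ∧ 0 < C ∧ ∀ (P : Params), P.d = 3 → P.L = L → ∀ k : ℕ, 1 ≤ k → k ≤ P.K →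
      (∀ y y' : Site P 0, |G0xi P a msq k y y'| ≤
          C * ((P.eta k * max (1 : ℝ) (supDist y y' : ℝ))⁻¹ * Real.exp (-(δ * (P.eta k * (supDist y y' : ℝ)))))) ∧
      (∀ (μ : Fin P.d) (y y' : Site P 0), |d1Kernel (P.eta k)⁻¹ μ (G0xi P a msq k) y y'| ≤
          C * (((P.eta k * max (1 : ℝ) (supDist y y' : ℝ)) ^ 2)⁻¹ * Real.exp (-(δ * (P.eta k * (supDist y y' : ℝ)))))) := by
  obtain ⟨δ₀, C₀, hδ₀, hC₀, HB⟩ := gpiece_bounds 3 L (by norm_num) hL ha hmsq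
  have hL1 : (1 : ℝ) < (L : ℝ) := by exact_mod_cast hL.2
  have hL0 : (0 : ℝ) < (L : ℝ) := by linarith
  -- the scale-sum constants for p = 1, 2
  set Cs1 : ℝ := (L : ℝ) / ((L : ℝ) - 1) * Real.exp (δ₀ / 2) +
      ((1 : ℕ).factorial : ℝ) / (δ₀ / 2) ^ 1 * (1 - Real.exp (-(δ₀ / 2 * ((L : ℝ) - 1))))⁻¹ + (1 - ((L : ℝ) ^ 1)⁻¹)⁻¹ with hCs1
  set Cs2 : ℝ := (L : ℝ) / ((L : ℝ) - 1) * Real.exp (δ₀ / 2) +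
      ((2 : ℕ).factorial : ℝ) / (δ₀ / 2) ^ 2 * (1 - Real.exp (-(δ₀ / 2 * ((L : ℝ) - 1))))⁻¹ + (1 - ((L : ℝ) ^ 2)⁻¹)⁻¹ with hCs2
  have hCs1' : 0 ≤ Cs1 := add_nonneg (scaleConst_nonneg hL1 hδ₀ 1) (zeroConst_nonneg hL1 le_rfl)
  have hCs2' : 0 ≤ Cs2 := add_nonneg (scaleConst_nonneg hL1 hδ₀ 2) (zeroConst_nonneg hL1 (by norm_num))
  refine ⟨δ₀ / 2, C₀ * (Cs1 + Cs2 + 1), half_pos hδ₀, mul_pos hC₀ (by linarith), fun P hPd hPL k hk1 hkK => ?_⟩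
  obtain ⟨hval, hrow, -, -⟩ := HB P hPd hPL k hk1 hkK
  have hd2 : 2 ≤ P.d := by omega
  have hε : 0 < P.eps := P.eps_pos
  have hs : 0 < P.spacing k := P.spacing_pos k
  have hη : 0 < P.eta k := eta_pos P k
  have hηL : P.eta k = ((P.L : ℝ) ^ k)⁻¹ := eta_eq_inv_pow P k
  have hPL' : ((P.L : ℝ)) = (L : ℝ) := by rw [hPL]
  -- the pieces at d = 3: value `(L^jε)^{−1}`, row difference `(L^jε)^{−2}`, decay in `supDist`
  have e23 : ((2 : ℝ) - ((P.d : ℕ) : ℝ)) = -1 := by rw [hPd]; norm_num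
  have e13 : ((1 : ℝ) - ((P.d : ℕ) : ℝ)) = -2 := by rw [hPd]; norm_num
  have hsj : ∀ j, P.spacing j = (P.L : ℝ) ^ j * P.eps := fun j => rfl
  have hval' : ∀ (j : ℕ) (y y' : Site P 0), |gpiece P a msq k j y y'| ≤
      C₀ * (P.eps⁻¹ * (((P.L : ℝ) ^ j)⁻¹ ^ 1 * Real.exp (-(δ₀ * (supDist y y' : ℝ) / (P.L : ℝ) ^ j)))) := by
    intro j y y'
    refine (hval j y y').trans ?_
    have hpre : P.spacing j ^ ((2 : ℝ) - ((P.d : ℕ) : ℝ)) = P.eps⁻¹ * ((P.L : ℝ) ^ j)⁻¹ ^ 1 := by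
      rw [e23, Real.rpow_neg_one, hsj, mul_inv, pow_one, mul_comm]
    rw [hpre, mul_assoc, mul_assoc]
    exact mul_le_mul_of_nonneg_left (mul_le_mul_of_nonneg_left
      (mul_le_mul_of_nonneg_left (piece_exp_le P hδ₀.le j y y') (by positivity)) (by positivity)) hC₀.le
  have hrow' : ∀ (j : ℕ) (μ : Fin P.d) (y y' : Site P 0), |d1Kernel P.eps⁻¹ μ (gpiece P a msq k j) y y'| ≤
      C₀ * ((P.eps ^ 2)⁻¹ * (((P.L : ℝ) ^ j)⁻¹ ^ 2 * Real.exp (-(δ₀ * (supDist y y' : ℝ) / (P.L : ℝ) ^ j)))) := by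
    intro j μ y y'
    refine (hrow j μ y y').trans ?_
    have hpre : P.spacing j ^ ((1 : ℝ) - ((P.d : ℕ) : ℝ)) = (P.eps ^ 2)⁻¹ * ((P.L : ℝ) ^ j)⁻¹ ^ 2 := by
      rw [e13, Real.rpow_neg (P.spacing_pos j).le, show (2 : ℝ) = ((2 : ℕ) : ℝ) by norm_num, Real.rpow_natCast, hsj,
        mul_pow, mul_inv, mul_comm]
      simp only [inv_pow]
    rw [hpre, mul_assoc, mul_assoc]
    exact mul_le_mul_of_nonneg_left (mul_le_mul_of_nonneg_left
      (mul_le_mul_of_nonneg_left (piece_exp_le P hδ₀.le j y y') (by positivity)) (by positivity)) hC₀.le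
  have hLk : ((P.L : ℝ) ^ k) ≠ 0 := pow_ne_zero _ P.cast_L_pos.ne'
  have hse1 : P.spacing k * P.eps⁻¹ = (P.L : ℝ) ^ k := by
    rw [hsj, mul_assoc, mul_inv_cancel₀ hε.ne', mul_one]
  have hse2 : P.spacing k ^ 2 * (P.eps ^ 2)⁻¹ = ((P.L : ℝ) ^ k) ^ 2 := by
    rw [hsj, mul_pow, mul_assoc, mul_inv_cancel₀ (pow_ne_zero 2 hε.ne'), mul_one]
  constructor
  · -- value
    intro y y'
    set n : ℕ := supDist y y' with hn
    have hmax0 : 0 < max (1 : ℝ) (n : ℝ) := lt_max_of_lt_left one_pos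
    have hsum : ∑ j ∈ range k, ((P.L : ℝ) ^ j)⁻¹ ^ 1 * Real.exp (-(δ₀ * n / (P.L : ℝ) ^ j)) ≤
        Cs1 * ((max (1 : ℝ) (n : ℝ))⁻¹ ^ 1 * Real.exp (-(δ₀ / 2 * ((n : ℝ) / (P.L : ℝ) ^ k)))) := by
      rw [hCs1, ← hPL']; exact scaleSum_le_max (one_lt_cast_L P) hδ₀ le_rfl k n
    have hG := G0xi_eq_sum_gpiece ha hmsq hd2 hk1 y y'
    rw [hPd, show 3 - 2 = 1 from rfl, pow_one] at hG
    rw [hG, abs_mul, abs_of_pos hs]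
    have h1 : |∑ j ∈ range k, gpiece P a msq k j y y'| ≤
        ∑ j ∈ range k, C₀ * (P.eps⁻¹ * (((P.L : ℝ) ^ j)⁻¹ ^ 1 * Real.exp (-(δ₀ * (n : ℝ) / (P.L : ℝ) ^ j)))) :=
      (Finset.abs_sum_le_sum_abs _ _).trans (Finset.sum_le_sum fun j _ => hval' j y y')
    rw [← Finset.mul_sum, ← Finset.mul_sum] at h1
    calc P.spacing k * |∑ j ∈ range k, gpiece P a msq k j y y'|
        ≤ P.spacing k * (C₀ * (P.eps⁻¹ * ∑ j ∈ range k, ((P.L : ℝ) ^ j)⁻¹ ^ 1 *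
            Real.exp (-(δ₀ * (n : ℝ) / (P.L : ℝ) ^ j)))) := mul_le_mul_of_nonneg_left h1 hs.le
      _ ≤ P.spacing k * (C₀ * (P.eps⁻¹ * (Cs1 * ((max (1 : ℝ) (n : ℝ))⁻¹ ^ 1 *
            Real.exp (-(δ₀ / 2 * ((n : ℝ) / (P.L : ℝ) ^ k))))))) := by gcongr
      _ = C₀ * Cs1 * ((P.eta k * max (1 : ℝ) (n : ℝ))⁻¹ * Real.exp (-(δ₀ / 2 * (P.eta k * (n : ℝ))))) := by
          have hdiv : (n : ℝ) / (P.L : ℝ) ^ k = ((P.L : ℝ) ^ k)⁻¹ * (n : ℝ) := div_eq_inv_mul _ _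
          simp only [pow_one]
          rw [hηL, hdiv, mul_inv, inv_inv]
          calc P.spacing k * (C₀ * (P.eps⁻¹ * (Cs1 * ((max (1 : ℝ) (n : ℝ))⁻¹ *
                Real.exp (-(δ₀ / 2 * (((P.L : ℝ) ^ k)⁻¹ * (n : ℝ))))))))
              = (P.spacing k * P.eps⁻¹) * (C₀ * Cs1 * ((max (1 : ℝ) (n : ℝ))⁻¹ *
                Real.exp (-(δ₀ / 2 * (((P.L : ℝ) ^ k)⁻¹ * (n : ℝ)))))) := by ring
            _ = _ := by rw [hse1]; ring
      _ ≤ C₀ * (Cs1 + Cs2 + 1) * ((P.eta k * max (1 : ℝ) (n : ℝ))⁻¹ * Real.exp (-(δ₀ / 2 * (P.eta k * (n : ℝ))))) := by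
          have h0 : 0 ≤ (P.eta k * max (1 : ℝ) (n : ℝ))⁻¹ * Real.exp (-(δ₀ / 2 * (P.eta k * (n : ℝ)))) := by positivity
          refine mul_le_mul_of_nonneg_right ?_ h0
          exact mul_le_mul_of_nonneg_left (by linarith) hC₀.le
  · -- row difference
    intro μ y y'
    set n : ℕ := supDist y y' with hn
    have hmax0 : 0 < max (1 : ℝ) (n : ℝ) := lt_max_of_lt_left one_pos
    have hsum : ∑ j ∈ range k, ((P.L : ℝ) ^ j)⁻¹ ^ 2 * Real.exp (-(δ₀ * n / (P.L : ℝ) ^ j)) ≤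
        Cs2 * ((max (1 : ℝ) (n : ℝ))⁻¹ ^ 2 * Real.exp (-(δ₀ / 2 * ((n : ℝ) / (P.L : ℝ) ^ k)))) := by
      rw [hCs2, ← hPL']; exact scaleSum_le_max (one_lt_cast_L P) hδ₀ (by norm_num) k n
    have hG := d1Kernel_G0xi_eq ha hmsq hd2 hk1 μ y y'
    rw [hPd, show 3 - 1 = 2 from rfl] at hG
    rw [hG, abs_mul, abs_of_pos (pow_pos hs 2)]
    have h1 : |∑ j ∈ range k, d1Kernel P.eps⁻¹ μ (gpiece P a msq k j) y y'| ≤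
        ∑ j ∈ range k, C₀ * ((P.eps ^ 2)⁻¹ * (((P.L : ℝ) ^ j)⁻¹ ^ 2 * Real.exp (-(δ₀ * (n : ℝ) / (P.L : ℝ) ^ j)))) :=
      (Finset.abs_sum_le_sum_abs _ _).trans (Finset.sum_le_sum fun j _ => hrow' j μ y y')
    rw [← Finset.mul_sum, ← Finset.mul_sum] at h1
    calc P.spacing k ^ 2 * |∑ j ∈ range k, d1Kernel P.eps⁻¹ μ (gpiece P a msq k j) y y'|
        ≤ P.spacing k ^ 2 * (C₀ * ((P.eps ^ 2)⁻¹ * ∑ j ∈ range k, ((P.L : ℝ) ^ j)⁻¹ ^ 2 *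
            Real.exp (-(δ₀ * (n : ℝ) / (P.L : ℝ) ^ j)))) := mul_le_mul_of_nonneg_left h1 (pow_pos hs 2).le
      _ ≤ P.spacing k ^ 2 * (C₀ * ((P.eps ^ 2)⁻¹ * (Cs2 * ((max (1 : ℝ) (n : ℝ))⁻¹ ^ 2 *
            Real.exp (-(δ₀ / 2 * ((n : ℝ) / (P.L : ℝ) ^ k))))))) := by gcongr
      _ = C₀ * Cs2 * (((P.eta k * max (1 : ℝ) (n : ℝ)) ^ 2)⁻¹ * Real.exp (-(δ₀ / 2 * (P.eta k * (n : ℝ))))) := by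
          have hdiv : (n : ℝ) / (P.L : ℝ) ^ k = ((P.L : ℝ) ^ k)⁻¹ * (n : ℝ) := div_eq_inv_mul _ _
          rw [hηL, hdiv, mul_pow]
          simp only [inv_pow, mul_inv, inv_inv]
          calc P.spacing k ^ 2 * (C₀ * ((P.eps ^ 2)⁻¹ * (Cs2 * (((max (1 : ℝ) (n : ℝ)) ^ 2)⁻¹ *
                Real.exp (-(δ₀ / 2 * (((P.L : ℝ) ^ k)⁻¹ * (n : ℝ))))))))
              = (P.spacing k ^ 2 * (P.eps ^ 2)⁻¹) * (C₀ * Cs2 * (((max (1 : ℝ) (n : ℝ)) ^ 2)⁻¹ *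
                Real.exp (-(δ₀ / 2 * (((P.L : ℝ) ^ k)⁻¹ * (n : ℝ)))))) := by ring
            _ = _ := by rw [hse2]; ring
      _ ≤ C₀ * (Cs1 + Cs2 + 1) * (((P.eta k * max (1 : ℝ) (n : ℝ)) ^ 2)⁻¹ *
            Real.exp (-(δ₀ / 2 * (P.eta k * (n : ℝ))))) := by
          have h0 : 0 ≤ ((P.eta k * max (1 : ℝ) (n : ℝ)) ^ 2)⁻¹ * Real.exp (-(δ₀ / 2 * (P.eta k * (n : ℝ)))) := by
            positivity
          refine mul_le_mul_of_nonneg_right ?_ h0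
          exact mul_le_mul_of_nonneg_left (by linarith) hC₀.le

/-- **The printed shapes off the diagonal** (`y′ ≠ y`, `max(1,|y−y′|) = |y−y′|`): `|G^ξ_k(0)(y,y′)| ≤ C(ξ|y−y′|)^{−1}e^{−δξ|y−y′|}` — the
hypothesis `hG` of `B3Bound316.abs_bracket316_le` — and `|(∂^ξ_μG^ξ_k(0))(y,y′)| ≤ C(ξ|y−y′|)^{−2}e^{−δξ|y−y′|}`, for every volume and
scale with the constants of `G0xi_bounds`. [cite: Balaban1983Higgs3, (3.16) p.437] -/
theorem G0xi_bounds_offdiag (L : ℕ) (hL : Odd L ∧ 1 < L) {a : ℝ} (ha : 0 < a) {msq : ℝ} (hmsq : 0 ≤ msq) :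
    ∃ δ C : ℝ, 0 < δ ∧ 0 < C ∧ ∀ (P : Params), P.d = 3 → P.L = L → ∀ k : ℕ, 1 ≤ k → k ≤ P.K →
      (∀ y y' : Site P 0, y' ≠ y → |G0xi P a msq k y y'| ≤
          C * (P.eta k * (supDist y y' : ℝ))⁻¹ * Real.exp (-(δ * (P.eta k * (supDist y y' : ℝ))))) ∧
      (∀ (μ : Fin P.d) (y y' : Site P 0), y' ≠ y → |d1Kernel (P.eta k)⁻¹ μ (G0xi P a msq k) y y'| ≤
          C * ((P.eta k * (supDist y y' : ℝ)) ^ 2)⁻¹ * Real.exp (-(δ * (P.eta k * (supDist y y' : ℝ))))) := by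
  obtain ⟨δ, C, hδ, hC, H⟩ := G0xi_bounds L hL ha hmsq
  refine ⟨δ, C, hδ, hC, fun P hPd hPL k hk1 hkK => ?_⟩
  obtain ⟨hv, hr⟩ := H P hPd hPL k hk1 hkK
  have hmax : ∀ {y y' : Site P 0}, y' ≠ y → max (1 : ℝ) (supDist y y' : ℝ) = (supDist y y' : ℝ) := by
    intro y y' hne
    have h0 : supDist y y' ≠ 0 := fun h => hne (((supDist_eq_zero_iff y y').mp h).symm)
    exact max_eq_right (by exact_mod_cast Nat.one_le_iff_ne_zero.mpr h0)
  refine ⟨fun y y' hne => ?_, fun μ y y' hne => ?_⟩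
  · have h := hv y y'; rw [hmax hne] at h; rw [mul_assoc]; exact h
  · have h := hr μ y y'; rw [hmax hne] at h; rw [mul_assoc]; exact h

/-- **p. 438 [PDF 28]: "ηG_k(x,x) is convergent to some finite constant"** — the BOUNDEDNESS half, for the zero-field TORUS propagator
`G_k(T_ε,0)`, uniformly in the volume and in the scale (v1.1 rider).  In the rescaled units of p. 437 (`x = L^kη·y`, `d = 3`) the
tadpole `ηG_k(x,x)` is `ξ·G^ξ_k(0;y,y)`; the diagonal case of `G0xi_bounds` (`max(1,|y − y|) = 1`) gives ONE constant `C` (a function of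
`L, a, m²`) with `ξ·|G^ξ_k(0;y,y)| ≤ C` for every volume `P = (3,L,m,K)`, every `1 ≤ k ≤ K` and every `y`.  (The existence of the
LIMIT is not claimed; the Neumann-box member is gen 5's `B3GkZeroBoxPointwise.eta_pow_mul_Gk_diag_le`.) [cite: Balaban1983Higgs3, (3.21) p.438] -/
theorem eta_mul_abs_G0xi_diag_le (L : ℕ) (hL : Odd L ∧ 1 < L) {a : ℝ} (ha : 0 < a) {msq : ℝ} (hmsq : 0 ≤ msq) :
    ∃ C : ℝ, 0 < C ∧ ∀ (P : Params), P.d = 3 → P.L = L → ∀ k : ℕ, 1 ≤ k → k ≤ P.K → ∀ y : Site P 0,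
      P.eta k * |G0xi P a msq k y y| ≤ C := by
  obtain ⟨δ, C, -, hC, H⟩ := G0xi_bounds L hL ha hmsq
  refine ⟨C, hC, fun P hPd hPL k hk1 hkK y => ?_⟩
  have h := (H P hPd hPL k hk1 hkK).1 y y
  have hη : 0 < P.eta k := eta_pos P k
  have h0 : max (1 : ℝ) (supDist y y : ℝ) = 1 := by
    rw [(supDist_eq_zero_iff y y).mpr rfl, Nat.cast_zero]; exact max_eq_left zero_le_one
  rw [h0, (supDist_eq_zero_iff y y).mpr rfl, Nat.cast_zero, mul_zero, mul_zero, neg_zero, Real.exp_zero, mul_one,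
    mul_one] at h
  calc P.eta k * |G0xi P a msq k y y| ≤ P.eta k * (C * (P.eta k)⁻¹) := mul_le_mul_of_nonneg_left h hη.le
    _ = C := by rw [mul_left_comm, mul_inv_cancel₀ hη.ne', mul_one]

end Bounds

end

end Literature.MathematicalPhysics.QuantumFieldTheory.Balaban1983to89.B3GkZeroTorusRescaled
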